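import Literature.AlgebraicGeometry.Frobenioids.Frobenioid
import Mathlib.Algebra.Group.MinimalAxioms
import HarnessLib

/-!
# Frobenioids I, Proposition 4.4: the units `O^×(A^birat)` of the birationalization, explicitly

Mochizuki, *The geometry of Frobenioids I: the general theory*, Kyushu J. Math. **62** (2008)
293–400, §4, Proposition 4.4 (i), (ii), (iv), kurims text pp. 82–85
[cite: MochizukiFrdI2008, Prop. 4.4 p.82].

For a Frobenioid `C → F_Φ` and `A ∈ Ob(C)`, Prop. 4.4 defines
`Hom^birat_C(A, B) := colim_{(A' → A) ∈ C^coa-pre_A} Hom_C(A', B)` (p. 82) and the category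
`C^birat`
(composition: (i), p. 84), and describes its base-identity endomorphisms explicitly: "A morphism of
`C^birat` is a base-identity endomorphism if and only if it arises from a pair
`(α : A' → A; φ : A' → A)`, where `α` is a co-angular pre-step in the indexing category of the
inductive limit defining `Hom^birat_C(A, A)`, and `α` and `φ` are base-equivalent" ((iv), p. 83);
such a class is linear iff `φ` is, and invertible iff `φ` is itself a co-angular pre-step ((iv):
"co-angular pre-step ↦ isomorphism").  This file constructs the resulting group

  `O^×(A^birat)` = { (α, φ) : `α, φ : A' → A` base-equivalent co-angular pre-steps } / (common
  co-angular pre-step refinement)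

directly — the *rational functions* at `A` ("the rational function monoid of the Frobenioid `C`",
(ii), p. 83, is the functor `A ↦ O^×(A^birat)`): the type `RatFrac F A` of pairs, the refinement
relation (an equivalence relation by the directedness of `C^coa-pre_A`, Def. 1.3 (iii)(d)), the
quotient `BiratUnits F hF A`, and its group law (composition in `C^birat`, computed on pairs by
refining, (i) p. 84; well defined because pre-steps are monomorphisms, Def. 1.3 (v)(a)).  The
homomorphism `O^×(A^birat) → Φ^gp(A)` with image `Φ^birat(A)` and kernel `O^×(A)` ((i), (iii)) is in
the companion file `BiratUnitsDiv.lean`.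

Dictionary: composition is diagrammatic (`κ ≫ α` is the paper's `α ∘ κ`); the class of `(α, φ)` is
the birational automorphism "`φ ∘ α⁻¹`"; the product of the classes of `(α, φ)` and `(β, ψ)` is the
class of `(κ ≫ α, λ ≫ ψ)` for any co-angular pre-steps `κ, λ` with `κ ≫ φ = λ ≫ β` (first `φ ∘ α⁻¹`,
then `ψ ∘ β⁻¹`).  Not here: the category `C^birat` itself and its Frobenioid structure (Prop. 4.4
(i)(ii) in full; seat L1-t3's interface `BiratData`), functoriality of `A ↦ O^×(A^birat)` in `A`.
-/

namespace Literature.AlgebraicGeometry.Frobenioids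

open CategoryTheory Opposite

universe w v v' u u'

namespace PreFrobenioid

variable {D : Type u} [Category.{v} D] {Φ : Dᵒᵖ ⥤ CommMonCat.{w}}
  {C : Type u'} [Category.{v'} C] (F : C ⥤ ElemFrobenioid Φ)

/-! ### Co-angular pre-steps: formal closure properties -/

/-- The identity is a pre-step. [cite: MochizukiFrdI2008, Def. 1.2(iii)] -/
theorem isPreStep_id' (A : C) : IsPreStep F (𝟙 A) := by
  refine ⟨degFr_id F A, ?_⟩
  change IsIso (Base F (𝟙 A))
  rw [base_id]
  infer_instance

variable {F} in
/-- Pre-steps are closed under composition (Frobenius degrees multiply, base isomorphisms compose).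
[cite: MochizukiFrdI2008, Def. 1.2(iii)] -/
theorem IsPreStep.comp_isPreStep {X Y Z : C} {f : X ⟶ Y} {g : Y ⟶ Z} (hf : IsPreStep F f)
    (hg : IsPreStep F g) : IsPreStep F (f ≫ g) := by
  refine ⟨?_, ?_⟩
  · change degFr F (f ≫ g) = 1
    rw [degFr_comp, hf.1, hg.1, mul_one]
  · change IsIso (Base F (f ≫ g))
    rw [base_comp]
    haveI : IsIso (Base F f) := hf.2
    haveI : IsIso (Base F g) := hg.2
    infer_instance

/-- In a totally epimorphic category an isomorphism is co-angular: in `φ = α ∘ β ∘ γ` with `φ` an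
isomorphism all three factors are isomorphisms ([FrdI] §0 p. 16: "if `α ∘ β` is an isomorphism,
then `α`, `β` are isomorphisms"). [cite: MochizukiFrdI2008, Def. 1.2(iii)] -/
theorem isCoAngular_of_isIso_of_isTotallyEpimorphic (hC : IsTotallyEpimorphic C) {A B : C}
    (φ : A ⟶ B) [IsIso φ] : IsCoAngular F φ := by
  intro X Y γ β α h _ _ _ _
  haveI : IsIso (γ ≫ β ≫ α) := by rw [h]; infer_instance
  haveI : IsIso (β ≫ α) := (hC.isIso_of_isIso_comp γ (β ≫ α)).1
  exact (hC.isIso_of_isIso_comp β α).2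

variable {F}

/-- The identity is a co-angular pre-step (in a Frobenioid, indeed in any pre-Frobenioid).
[cite: MochizukiFrdI2008, Def. 1.3(iii)] -/
theorem isCoAngularPreStep_id (hF : IsFrobenioid F) (A : C) : IsCoAngularPreStep F (𝟙 A) :=
  ⟨isCoAngular_of_isIso_of_isTotallyEpimorphic F hF.isPreFrobenioid.isTotallyEpimorphic (𝟙 A),
    isPreStep_id' F A⟩

/-- Co-angular pre-steps are closed under composition (Def. 1.3 (iii)(a) for co-angularity).
[cite: MochizukiFrdI2008, Def. 1.3(iii)] -/
theorem IsCoAngularPreStep.comp (hF : IsFrobenioid F) {X Y Z : C} {f : X ⟶ Y} {g : Y ⟶ Z}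
    (hf : IsCoAngularPreStep F f) (hg : IsCoAngularPreStep F g) : IsCoAngularPreStep F (f ≫ g) :=
  ⟨hF.iii_a f g hf.1 hg.1, hf.2.comp_isPreStep hg.2⟩

/-- An element of `O^×(A)` (a base-identity linear automorphism) is a co-angular pre-step.
[cite: MochizukiFrdI2008, Def. 1.3(iii)] -/
theorem isCoAngularPreStep_of_mem_unitsSubgroup (hF : IsFrobenioid F) {A : C} (u : Aut A)
    (hu : u ∈ unitsSubgroup F A) : IsCoAngularPreStep F u.hom := by
  refine ⟨isCoAngular_of_isIso_of_isTotallyEpimorphic F hF.isPreFrobenioid.isTotallyEpimorphic _,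
    hu.2, ?_⟩
  change IsIso (Base F u.hom)
  rw [hu.1]
  infer_instance

/-- Co-angular pre-steps are monomorphisms (Def. 1.3 (v)(a)). [cite: MochizukiFrdI2008, Def.
1.3(v)] -/
theorem IsCoAngularPreStep.mono (hF : IsFrobenioid F) {X Y : C} {f : X ⟶ Y}
    (hf : IsCoAngularPreStep F f) : Mono f :=
  hF.v_a f hf.2

/-! ### Directedness of `C^coa-pre_A` (Definition 1.3 (iii)(d)) -/

/-- Two co-angular pre-steps `β : B → A`, `β' : B' → A` admit a common refinement by co-angular
pre-steps: `κ ≫ β = κ' ≫ β'` — the indexing category `C^coa-pre_A` of `Hom^birat` is (co)directed,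
by the equivalence `C^coa-pre_A ⥲ Order(Φ(A))ᵒᵖ` of Def. 1.3 (iii)(d) (refine to the product of the
two divisors). [cite: MochizukiFrdI2008, Prop. 4.4 p.82] -/
theorem exists_common_refinement (hF : IsFrobenioid F) {A B B' : C} (β : B ⟶ A) (β' : B' ⟶ A)
    (hβ : IsCoAngularPreStep F β) (hβ' : IsCoAngularPreStep F β') :
    ∃ (E : C) (κ : E ⟶ B) (κ' : E ⟶ B'), IsCoAngularPreStep F κ ∧ IsCoAngularPreStep F κ' ∧
      κ ≫ β = κ' ≫ β' := by
  obtain ⟨E, ψ, hψ, hψdiv⟩ :=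
    hF.iii_d_over_surj A (invDiv F β hβ.2.2 * invDiv F β' hβ'.2.2)
  obtain ⟨κ, hκ, hκβ⟩ := hF.iii_d_over_full ψ β hψ hβ (by rw [hψdiv]; exact dvd_mul_right _ _)
  obtain ⟨κ', hκ', hκβ'⟩ := hF.iii_d_over_full ψ β' hψ hβ' (by rw [hψdiv]; exact dvd_mul_left _ _)
  exact ⟨E, κ, κ', hκ, hκ', by rw [hκβ, hκβ']⟩

/-! ### Rational functions at `A`: pairs of base-equivalent co-angular pre-steps -/

variable (F) in
/-- A *fraction* at `A`: a pair `(α, φ)` of base-equivalent co-angular pre-steps `A' → A` with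
common
domain — the data presenting a base-identity linear automorphism "`φ ∘ α⁻¹`" of `A^birat` (FrdI
Prop. 4.4 (iv), p. 83: base-identity endomorphisms of `C^birat` arise from base-equivalent pairs
`(α : A' → A; φ : A' → A)` with `α` a co-angular pre-step; the class is an automorphism iff `φ` is a
co-angular pre-step as well). [cite: MochizukiFrdI2008, Prop. 4.4(iv) p.83] -/
structure RatFrac (A : C) : Type (max u' v') where
  /-- the common domain `A'` -/
  src : C
  /-- the denominator `α : A' → A` (inverted in `C^birat`) -/
  den : src ⟶ A
  /-- the numerator `φ : A' → A` -/
  num : src ⟶ A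
  /-- `α` is a co-angular pre-step -/
  den_mem : IsCoAngularPreStep F den
  /-- `φ` is a co-angular pre-step -/
  num_mem : IsCoAngularPreStep F num
  /-- `α`, `φ` are base-equivalent -/
  baseEq : BaseEquivalent F den num

namespace RatFrac

variable {A : C}

/-- The refinement relation: `(α, φ) ∼ (α', φ')` if `ε ≫ α = ε' ≫ α'` and `ε ≫ φ = ε' ≫ φ'` for some
co-angular pre-steps `ε, ε'` (equality in the inductive limit `Hom^birat_C(A, A)`, whose transition
maps are injective since `C` is totally epimorphic). [cite: MochizukiFrdI2008, Prop. 4.4 p.82] -/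
def Rel (p q : RatFrac F A) : Prop :=
  ∃ (E : C) (ε : E ⟶ p.src) (ε' : E ⟶ q.src), IsCoAngularPreStep F ε ∧ IsCoAngularPreStep F ε' ∧
    ε ≫ p.den = ε' ≫ q.den ∧ ε ≫ p.num = ε' ≫ q.num

/-- The refinement relation is reflexive. [cite: MochizukiFrdI2008, Prop. 4.4 p.82] -/
theorem Rel.refl (hF : IsFrobenioid F) (p : RatFrac F A) : Rel p p :=
  ⟨p.src, 𝟙 _, 𝟙 _, isCoAngularPreStep_id hF _, isCoAngularPreStep_id hF _, rfl, rfl⟩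

/-- The refinement relation is symmetric. [cite: MochizukiFrdI2008, Prop. 4.4 p.82] -/
theorem Rel.symm {p q : RatFrac F A} (h : Rel p q) : Rel q p := by
  obtain ⟨E, ε, ε', hε, hε', h₁, h₂⟩ := h
  exact ⟨E, ε', ε, hε', hε, h₁.symm, h₂.symm⟩

/-- The refinement relation is transitive (refine the two middle pre-steps, Def. 1.3 (iii)(d)).
[cite: MochizukiFrdI2008, Prop. 4.4 p.82] -/
theorem Rel.trans (hF : IsFrobenioid F) {p q r : RatFrac F A} (h : Rel p q) (h' : Rel q r) :
    Rel p r := by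
  obtain ⟨E, ε, ε', hε, hε', h₁, h₂⟩ := h
  obtain ⟨E', δ, δ', hδ, hδ', h₁', h₂'⟩ := h'
  obtain ⟨T, κ, κ', hκ, hκ', hT⟩ := exists_common_refinement hF ε' δ hε' hδ
  refine ⟨T, κ ≫ ε, κ' ≫ δ', hκ.comp hF hε, hκ'.comp hF hδ', ?_, ?_⟩
  · rw [Category.assoc, h₁, ← Category.assoc, hT, Category.assoc, h₁', Category.assoc]
  · rw [Category.assoc, h₂, ← Category.assoc, hT, Category.assoc, h₂', Category.assoc]

variable (F) in
/-- The refinement relation as a setoid (for a Frobenioid). [cite: MochizukiFrdI2008, Prop. 4.4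
p.82] -/
def setoid (hF : IsFrobenioid F) (A : C) : Setoid (RatFrac F A) where
  r := Rel
  iseqv := ⟨Rel.refl hF, Rel.symm, Rel.trans hF⟩

/-- The unit fraction `(id, id)`. [cite: MochizukiFrdI2008, Prop. 4.4(i) p.84] -/
def one (hF : IsFrobenioid F) (A : C) : RatFrac F A :=
  ⟨A, 𝟙 A, 𝟙 A, isCoAngularPreStep_id hF A, isCoAngularPreStep_id hF A, rfl⟩

/-- The inverse fraction: `(α, φ)⁻¹ = (φ, α)`. [cite: MochizukiFrdI2008, Prop. 4.4(i) p.84] -/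
def inv (p : RatFrac F A) : RatFrac F A :=
  ⟨p.src, p.num, p.den, p.num_mem, p.den_mem, p.baseEq.symm⟩

/-- A *refinement datum* for composing `(α, φ)` with `(β, ψ)`: co-angular pre-steps `κ, λ` with
`κ ≫ φ = λ ≫ β` (the commutative square of the proof of Prop. 4.4 (i), p. 84, here for pre-steps).
[cite: MochizukiFrdI2008, Prop. 4.4(i) p.84] -/
structure Refinement (p q : RatFrac F A) : Type (max u' v') where
  /-- the apex -/
  apex : C
  /-- `κ : E → A'` -/
  left : apex ⟶ p.src
  /-- `λ : E → B'` -/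
  right : apex ⟶ q.src
  /-- `κ` is a co-angular pre-step -/
  left_mem : IsCoAngularPreStep F left
  /-- `λ` is a co-angular pre-step -/
  right_mem : IsCoAngularPreStep F right
  /-- the square `κ ≫ φ = λ ≫ β` -/
  w : left ≫ p.num = right ≫ q.den

/-- Refinement data exist (directedness). [cite: MochizukiFrdI2008, Prop. 4.4(i) p.84] -/
theorem nonempty_refinement (hF : IsFrobenioid F) (p q : RatFrac F A) :
    Nonempty (Refinement p q) := by
  obtain ⟨E, κ, κ', hκ, hκ', h⟩ := exists_common_refinement hF p.num q.den p.num_mem q.den_mem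
  exact ⟨⟨E, κ, κ', hκ, hκ', h⟩⟩

/-- A chosen refinement datum. [cite: MochizukiFrdI2008, Prop. 4.4(i) p.84] -/
noncomputable def someRefinement (hF : IsFrobenioid F) (p q : RatFrac F A) : Refinement p q :=
  Classical.choice (nonempty_refinement hF p q)

/-- The product fraction computed with a given refinement: `(κ ≫ α, λ ≫ ψ)` — the composite
"`(ψ ∘ β⁻¹) ∘ (φ ∘ α⁻¹) = (ψ ∘ λ) ∘ (α ∘ κ)⁻¹`" in `C^birat`. [cite: MochizukiFrdI2008, Prop.
4.4(i) p.84] -/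
def mulWith (hF : IsFrobenioid F) (p q : RatFrac F A) (R : Refinement p q) : RatFrac F A where
  src := R.apex
  den := R.left ≫ p.den
  num := R.right ≫ q.num
  den_mem := R.left_mem.comp hF p.den_mem
  num_mem := R.right_mem.comp hF q.num_mem
  baseEq := by
    change Base F (R.left ≫ p.den) = Base F (R.right ≫ q.num)
    have h := congrArg (Base F) R.w
    rw [base_comp, base_comp] at h
    rw [base_comp, base_comp, p.baseEq, h, q.baseEq]

/-- The product fraction (with the chosen refinement). [cite: MochizukiFrdI2008, Prop. 4.4(i) p.84]
-/
noncomputable def mul (hF : IsFrobenioid F) (p q : RatFrac F A) : RatFrac F A :=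
  mulWith hF p q (someRefinement hF p q)

/-- Independence of the refinement: any two refinement data give equivalent products (compare on a
common refinement of the two left legs; the right legs then agree because the pre-step `β` is a
monomorphism). [cite: MochizukiFrdI2008, Prop. 4.4(i) p.84] -/
theorem mulWith_rel (hF : IsFrobenioid F) (p q : RatFrac F A) (R R' : Refinement p q) :
    Rel (mulWith hF p q R) (mulWith hF p q R') := by
  obtain ⟨T, μ, μ', hμ, hμ', hT⟩ :=
    exists_common_refinement hF R.left R'.left R.left_mem R'.left_mem
  haveI : Mono q.den := q.den_mem.mono hF
  have hright : μ ≫ R.right = μ' ≫ R'.right := by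
    rw [← cancel_mono q.den, Category.assoc, Category.assoc, ← R.w, ← R'.w, ← Category.assoc,
      ← Category.assoc, hT]
  refine ⟨T, μ, μ', hμ, hμ', ?_, ?_⟩
  · change μ ≫ R.left ≫ p.den = μ' ≫ R'.left ≫ p.den
    rw [← Category.assoc, hT, Category.assoc]
  · change μ ≫ R.right ≫ q.num = μ' ≫ R'.right ≫ q.num
    rw [← Category.assoc, hright, Category.assoc]

/-- The product respects the refinement relation in the first variable.
[cite: MochizukiFrdI2008, Prop. 4.4(i) p.84] -/
theorem mul_rel_left (hF : IsFrobenioid F) {p p' : RatFrac F A} (q : RatFrac F A) (h : Rel p p') :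
    Rel (mul hF p q) (mul hF p' q) := by
  obtain ⟨E, ε, ε', hε, hε', hden, hnum⟩ := h
  let R := someRefinement hF p q
  obtain ⟨T, ν, ν', hν, hν', hT⟩ := exists_common_refinement hF R.left ε R.left_mem hε
  -- a refinement datum for `(p', q)` through `T`
  let R' : Refinement p' q :=
    { apex := T
      left := ν' ≫ ε'
      right := ν ≫ R.right
      left_mem := hν'.comp hF hε'
      right_mem := hν.comp hF R.right_mem
      w := by rw [Category.assoc, ← hnum, ← Category.assoc, ← hT, Category.assoc, R.w,
        Category.assoc] }
  change Rel (mul hF p q) (mulWith hF p' q (someRefinement hF p' q))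
  refine Rel.trans hF ?_ (mulWith_rel hF p' q R' (someRefinement hF p' q))
  -- `mul p q ∼ mulWith p' q R'` via `(ν, 𝟙)`
  refine ⟨T, ν, 𝟙 T, hν, isCoAngularPreStep_id hF T, ?_, ?_⟩
  · change ν ≫ R.left ≫ p.den = 𝟙 T ≫ (ν' ≫ ε') ≫ p'.den
    rw [Category.id_comp, Category.assoc, ← hden, ← Category.assoc ν', ← hT, Category.assoc]
  · change ν ≫ R.right ≫ q.num = 𝟙 T ≫ (ν ≫ R.right) ≫ q.num
    rw [Category.id_comp, Category.assoc]

/-- The product respects the refinement relation in the second variable.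
[cite: MochizukiFrdI2008, Prop. 4.4(i) p.84] -/
theorem mul_rel_right (hF : IsFrobenioid F) (p : RatFrac F A) {q q' : RatFrac F A} (h : Rel q q') :
    Rel (mul hF p q) (mul hF p q') := by
  obtain ⟨E, ε, ε', hε, hε', hden, hnum⟩ := h
  let R := someRefinement hF p q
  obtain ⟨T, ν, ν', hν, hν', hT⟩ := exists_common_refinement hF R.right ε R.right_mem hε
  let R' : Refinement p q' :=
    { apex := T
      left := ν ≫ R.left
      right := ν' ≫ ε'
      left_mem := hν.comp hF R.left_mem
      right_mem := hν'.comp hF hε'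
      w := by rw [Category.assoc, R.w, ← Category.assoc, hT, Category.assoc, hden,
        Category.assoc] }
  change Rel (mul hF p q) (mulWith hF p q' (someRefinement hF p q'))
  refine Rel.trans hF ?_ (mulWith_rel hF p q' R' (someRefinement hF p q'))
  refine ⟨T, ν, 𝟙 T, hν, isCoAngularPreStep_id hF T, ?_, ?_⟩
  · change ν ≫ R.left ≫ p.den = 𝟙 T ≫ (ν ≫ R.left) ≫ p.den
    rw [Category.id_comp, Category.assoc]
  · change ν ≫ R.right ≫ q.num = 𝟙 T ≫ (ν' ≫ ε') ≫ q'.num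
    rw [Category.id_comp, Category.assoc, ← hnum, ← Category.assoc ν', ← hT, Category.assoc]

/-- Inversion respects the refinement relation. [cite: MochizukiFrdI2008, Prop. 4.4(i) p.84] -/
theorem inv_rel {p q : RatFrac F A} (h : Rel p q) : Rel (inv p) (inv q) := by
  obtain ⟨E, ε, ε', hε, hε', hden, hnum⟩ := h
  exact ⟨E, ε, ε', hε, hε', hnum, hden⟩

end RatFrac

/-! ### Group laws on fractions, up to refinement -/

namespace RatFrac

variable {hF : IsFrobenioid F} {A : C}

variable (hF) in
/-- Associativity of the product of fractions up to refinement: compute both bracketings on a common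
triple refinement. [cite: MochizukiFrdI2008, Prop. 4.4(i) p.84] -/
theorem mul_assoc_rel (p q r : RatFrac F A) :
    Rel (mul hF (mul hF p q) r) (mul hF p (mul hF q r)) := by
  -- a triple refinement `a, b, c` with `a ≫ φ = b ≫ β`, `b ≫ ψ = c ≫ γ`
  let R := someRefinement hF p q
  obtain ⟨T, m, c, hm, hc, hT⟩ :=
    exists_common_refinement hF (R.right ≫ q.num) r.den (R.right_mem.comp hF q.num_mem) r.den_mem
  let Rpq : Refinement p q :=
    { apex := T, left := m ≫ R.left, right := m ≫ R.right, left_mem := hm.comp hF R.left_mem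
      right_mem := hm.comp hF R.right_mem
      w := by rw [Category.assoc, R.w, Category.assoc] }
  let Rqr : Refinement q r :=
    { apex := T, left := m ≫ R.right, right := c, left_mem := hm.comp hF R.right_mem
      right_mem := hc, w := by rw [Category.assoc, hT] }
  let R1 : Refinement (mulWith hF p q Rpq) r :=
    { apex := T, left := 𝟙 T, right := c, left_mem := isCoAngularPreStep_id hF T, right_mem := hc
      w := by
        change 𝟙 T ≫ (m ≫ R.right) ≫ q.num = c ≫ r.den
        rw [Category.id_comp, Category.assoc, hT] }
  let R2 : Refinement p (mulWith hF q r Rqr) :=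
    { apex := T, left := m ≫ R.left, right := 𝟙 T, left_mem := hm.comp hF R.left_mem
      right_mem := isCoAngularPreStep_id hF T
      w := by
        change (m ≫ R.left) ≫ p.num = 𝟙 T ≫ (m ≫ R.right) ≫ q.den
        rw [Category.id_comp, Category.assoc, R.w, Category.assoc] }
  -- `(p q) r ∼ mulWith (mulWith p q Rpq) r R1`
  have h1 : Rel (mul hF (mul hF p q) r) (mulWith hF (mulWith hF p q Rpq) r R1) :=
    Rel.trans hF (mul_rel_left hF r (mulWith_rel hF p q _ Rpq))
      (mulWith_rel hF (mulWith hF p q Rpq) r _ R1)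
  -- `p (q r) ∼ mulWith p (mulWith q r Rqr) R2`
  have h2 : Rel (mul hF p (mul hF q r)) (mulWith hF p (mulWith hF q r Rqr) R2) :=
    Rel.trans hF (mul_rel_right hF p (mulWith_rel hF q r _ Rqr))
      (mulWith_rel hF p (mulWith hF q r Rqr) _ R2)
  refine Rel.trans hF h1 (Rel.trans hF ?_ h2.symm)
  refine ⟨T, 𝟙 T, 𝟙 T, isCoAngularPreStep_id hF T, isCoAngularPreStep_id hF T, ?_, ?_⟩
  · change 𝟙 T ≫ 𝟙 T ≫ (m ≫ R.left) ≫ p.den = 𝟙 T ≫ (m ≫ R.left) ≫ p.den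
    simp only [Category.id_comp]
  · change 𝟙 T ≫ c ≫ r.num = 𝟙 T ≫ 𝟙 T ≫ c ≫ r.num
    simp only [Category.id_comp]

variable (hF) in
/-- Left unit up to refinement: `(α, φ)` then `(id, id)` is `(α ≫ id, id ≫ φ) ∼ (α, φ)`.
[cite: MochizukiFrdI2008, Prop. 4.4(i) p.84] -/
theorem one_mul_rel (q : RatFrac F A) : Rel (mul hF (one hF A) q) q := by
  let R : Refinement (one hF A) q :=
    { apex := q.src, left := q.den, right := 𝟙 _, left_mem := q.den_mem
      right_mem := isCoAngularPreStep_id hF _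
      w := by
        change q.den ≫ 𝟙 A = 𝟙 _ ≫ q.den
        rw [Category.comp_id, Category.id_comp] }
  refine Rel.trans hF (mulWith_rel hF _ q _ R) ?_
  refine ⟨q.src, 𝟙 _, 𝟙 _, isCoAngularPreStep_id hF _, isCoAngularPreStep_id hF _, ?_, ?_⟩
  · change 𝟙 _ ≫ q.den ≫ 𝟙 A = 𝟙 _ ≫ q.den
    rw [Category.comp_id]
  · change 𝟙 _ ≫ 𝟙 _ ≫ q.num = 𝟙 _ ≫ q.num
    rw [Category.id_comp]

variable (hF) in
/-- Inverse up to refinement: `(φ, α)` then `(α, φ)` is `(φ, φ) ∼ (id, id)`.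
[cite: MochizukiFrdI2008, Prop. 4.4(i) p.84] -/
theorem inv_mul_rel (p : RatFrac F A) : Rel (mul hF (inv p) p) (one hF A) := by
  let R : Refinement (inv p) p :=
    { apex := p.src, left := 𝟙 _, right := 𝟙 _, left_mem := isCoAngularPreStep_id hF _
      right_mem := isCoAngularPreStep_id hF _, w := rfl }
  refine Rel.trans hF (mulWith_rel hF _ p _ R) ?_
  refine ⟨p.src, 𝟙 _, p.num, isCoAngularPreStep_id hF _, p.num_mem, ?_, ?_⟩
  · change 𝟙 _ ≫ 𝟙 _ ≫ p.num = p.num ≫ 𝟙 A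
    rw [Category.id_comp, Category.id_comp, Category.comp_id]
  · change 𝟙 _ ≫ 𝟙 _ ≫ p.num = p.num ≫ 𝟙 A
    rw [Category.id_comp, Category.id_comp, Category.comp_id]

end RatFrac

/-! ### `O^×(A^birat)` -/

variable (F) in
/-- `O^×(A^birat)`: the group of base-identity linear automorphisms of the image `A^birat` of `A` in
the birationalization `C^birat`, in the explicit description of FrdI Prop. 4.4 (iv) p. 83 — classes
of pairs `(α, φ)` of base-equivalent co-angular pre-steps into `A` modulo common refinement.  Its
elements are the *rational functions* at `A`: `A ↦ O^×(A^birat)` is "the rational function monoid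
of the Frobenioid `C`" (Prop. 4.4 (ii)). [cite: MochizukiFrdI2008, Prop. 4.4(ii) p.83] -/
def BiratUnits (hF : IsFrobenioid F) (A : C) : Type (max u' v') :=
  Quotient (RatFrac.setoid F hF A)

namespace BiratUnits

variable {hF : IsFrobenioid F} {A : C}

variable (hF) in
/-- The class of a fraction `(α, φ)` in `O^×(A^birat)` (the birational automorphism "`φ ∘ α⁻¹`").
[cite: MochizukiFrdI2008, Prop. 4.4(iv) p.83] -/
def mk (p : RatFrac F A) : BiratUnits F hF A := Quotient.mk (RatFrac.setoid F hF A) p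

/-- Every element of `O^×(A^birat)` is the class of a fraction. [cite: MochizukiFrdI2008, Prop.
4.4(iv) p.83] -/
theorem mk_surjective : Function.Surjective (mk hF : RatFrac F A → BiratUnits F hF A) :=
  Quotient.mk_surjective

/-- Two fractions have the same class iff they admit a common refinement.
[cite: MochizukiFrdI2008, Prop. 4.4 p.82] -/
theorem mk_eq_mk_iff {p q : RatFrac F A} : mk hF p = mk hF q ↔ RatFrac.Rel p q :=
  Quotient.eq (r := RatFrac.setoid F hF A)

/-- Refinement-related fractions have the same class. [cite: MochizukiFrdI2008, Prop. 4.4 p.82] -/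
theorem sound {p q : RatFrac F A} (h : RatFrac.Rel p q) : mk hF p = mk hF q := mk_eq_mk_iff.mpr h

/-- Multiplication: composition of birational automorphisms in the order of Mathlib's `Aut`/`End`
(`x * y` = "`x ∘ y`", apply `y` first): `[p] * [q] := [q then p]`.
[cite: MochizukiFrdI2008, Prop. 4.4(i) p.84] -/
noncomputable instance : Mul (BiratUnits F hF A) :=
  ⟨Quotient.map₂ (fun p q => RatFrac.mul hF q p) fun _ _ h₁ _ _ h₂ =>
    RatFrac.Rel.trans hF (RatFrac.mul_rel_left hF _ h₂) (RatFrac.mul_rel_right hF _ h₁)⟩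

/-- The unit: the class of `(id, id)`. [cite: MochizukiFrdI2008, Prop. 4.4(i) p.84] -/
instance : One (BiratUnits F hF A) := ⟨mk hF (RatFrac.one hF A)⟩

/-- Inversion: `[(α, φ)]⁻¹ = [(φ, α)]`. [cite: MochizukiFrdI2008, Prop. 4.4(i) p.84] -/
instance : Inv (BiratUnits F hF A) := ⟨Quotient.map RatFrac.inv fun _ _ h => RatFrac.inv_rel h⟩

/-- The product of classes is the class of the composite fraction. [cite: MochizukiFrdI2008, Prop.
4.4(i) p.84] -/
theorem mk_mul_mk (p q : RatFrac F A) : mk hF p * mk hF q = mk hF (RatFrac.mul hF q p) := rfl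

/-- The unit is the class of `(id, id)`. [cite: MochizukiFrdI2008, Prop. 4.4(i) p.84] -/
theorem one_def : (1 : BiratUnits F hF A) = mk hF (RatFrac.one hF A) := rfl

/-- The inverse of a class. [cite: MochizukiFrdI2008, Prop. 4.4(i) p.84] -/
theorem inv_mk (p : RatFrac F A) : (mk hF p)⁻¹ = mk hF (RatFrac.inv p) := rfl

/-- The product may be computed with ANY refinement datum. [cite: MochizukiFrdI2008, Prop. 4.4(i)
p.84] -/
theorem mk_mul_mk_eq (p q : RatFrac F A) (R : RatFrac.Refinement q p) :
    mk hF p * mk hF q = mk hF (RatFrac.mulWith hF q p R) :=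
  sound (RatFrac.mulWith_rel hF q p _ R)

/-- `O^×(A^birat)` is a group under composition of birational automorphisms
(FrdI Prop. 4.4 (i)/(ii): `C^birat` is a category — indeed a Frobenioid — so its base-identity
linear automorphisms of `A^birat` form a group). [cite: MochizukiFrdI2008, Prop. 4.4(ii) p.83] -/
noncomputable instance instGroup : Group (BiratUnits F hF A) :=
  Group.ofRightAxioms
    (fun x y z => by
      obtain ⟨p, rfl⟩ := mk_surjective x
      obtain ⟨q, rfl⟩ := mk_surjective y
      obtain ⟨r, rfl⟩ := mk_surjective z
      exact sound (RatFrac.mul_assoc_rel hF r q p).symm)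
    (fun x => by
      obtain ⟨p, rfl⟩ := mk_surjective x
      exact sound (RatFrac.one_mul_rel hF p))
    (fun x => by
      obtain ⟨p, rfl⟩ := mk_surjective x
      exact sound (RatFrac.inv_mul_rel hF p))

end BiratUnits

end PreFrobenioid

end Literature.AlgebraicGeometry.Frobenioids
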